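import Mathlib.Analysis.Convex.Function
import Mathlib.Analysis.Convex.Slope
import Mathlib.Analysis.SpecialFunctions.Sqrt
import Mathlib.Topology.Semicontinuity.Basic
import Mathlib.Topology.Order.Compact
import Mathlib.Topology.MetricSpace.Sequences
import Summits.AnomalousDissipation.AnomalousDissipation.Theorems.TaylorCertificatesFloorCertificateStubFanMinimax
import Summits.HubbardSuperconductivity.HubbardSuperconductivity.Theorems.ThermalWedgeTwSeededEnsembleEquivalenceRDeepUniqOfStrictConcavity
import Summits.HubbardSuperconductivity.HubbardSuperconductivity.Theorems.ThermalWedgeTwSeededEnsembleEquivalenceRColdRegularityOfParts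

/-!
# Crux `TwSeededEnsembleEquivalenceR` (stmt-HubbardSuperconductivity-15581), line `cold-floor-collapse`
# (slug `Sketch`, skeleton v8) — SUBGRADIENT SELECTION BY MINIMAX: NoSplit at one `μ` from concavity in `s = h²`

Support file (`--supports stmt-HubbardSuperconductivity-15581`; sorry-free; no definition; route-file free).
Companion of `…RNoSplitOfConcavity` (the quantified glues for skeleton v8); this file holds the analysis.

Skeleton v8 (lead c10, block two-phase pinning) closes the crux from finite-dimensional stubs and ONE qualitative
property of the cold sourced limit pressure `q`, **NoSplit** (fifth hypothesis of `stub_twoPhaseClosure`): at an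
interior `μ` of the window every subgradient `ν` of `B = sup_{|h| ≤ R} [q(·,h) − h²/g]` is a subgradient of `q(·,h₀)`
for SOME maximiser `h₀`. v8 derives it from FLOOR + DEEP-UNIQ′ (unique optimal modulus ⟸ STRICT `s`-concavity with a
volume-uniform modulus). Here NoSplit is recognised as a MINIMAX statement, which needs only NON-STRICT concavity:

* `nsc_subgradient_selection` (pure convex analysis) — for `G(μ', σ)` convex in `μ'` and CONCAVE in a parameter
  `σ` (compact intervals, separately continuous), every subgradient `ν` of `B = sup_σ G(·,σ)` at `μ` is a subgradient
  of `G(·,σ₀)` for some maximiser `σ₀` of `G(μ,·)`. Proof: `φ(μ',σ) = G(μ',σ) − νμ'` is convex–concave, so Ky Fan's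
  convex-like minimax principle (`fan_minimax`, tree) yields for every `ε > 0` one `σ_ε` with
  `φ(μ',σ_ε) > B(μ) − νμ − ε` for all `μ'`; a limit point `σ₀` of `σ_ε` (compactness, continuity in `σ`) is a
  maximiser at `μ` carrying `ν`. No uniqueness, no strictness, no `μ`-differentiability.
* `nsc_supportingLine_of_local` — a supporting line of a convex function on a neighbourhood is a global one.
* `nsc_noSplitAt_of_concaveOn` (model core, any `β > 0`, box `[−R,R]`, floor level `0 ≤ s_f ≤ R²`) — for a pointwise
  limit `q` of the sourced torus pressure on `[μ₁,μ₂] × [−R,R]`: if every maximiser of the payoff has `h² ≥ s_f` on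
  the window and `s ↦ q(μ',√s)` is concave on `[s_f, R²]` for interior `μ'`, then NoSplit holds at every interior `μ`.
  (Evenness `partitionFn_dWaveSourceTorus_neg` and the `8√2` / `2` Lipschitz bounds and the `μ`-convexity of the
  finite-volume pressure pass to the limit; the suprema over `s ∈ [s_f,R²]` and over `h ∈ [−R,R]` agree by the
  floor; the selection lemma is applied on a closed neighbourhood of `μ` inside the open window.)
* `nsc_concaveOn_sqrt_of_finiteVolume` — eventual finite-volume concavity of `s ↦ p̃_L(β; U, μ, √s)` on `[s_f,R²]`
  passes to every pointwise limit (no modulus needed, contrast `dsc_deepStrictConcavity_of_finiteVolumeModulus`).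

[folklore composition; K. Fan, Proc. Nat. Acad. Sci. USA 39 (1953) 42–47, Thm 2; J.-B. Hiriart-Urruty,
C. Lemaréchal, Convex Analysis and Minimization Algorithms I (1993), Thm VI.4.4.2 (subdifferential of a max
function)]
-/

set_option linter.dupNamespace false

namespace Summit.HubbardSuperconductivity.HubbardSuperconductivity.Theorems

open Set Filter Topology Matrix Literature.MathematicalPhysics.QuantumLattice
open Summit.AnomalousDissipation.AnomalousDissipation.Theorems.TaylorCertificatesFloorCertificate
open Summit.HubbardSuperconductivity.HubbardSuperconductivity.Theorems.TwSourcedCondensation.Negative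
open Summit.HubbardSuperconductivity.HubbardSuperconductivity.Theorems.TwSeededEnsembleEquivalenceR.ColdFloorLine
open scoped ComplexOrder

noncomputable section

/-! ### Pure convex analysis: subgradient selection by minimax -/

/-- **Subgradient selection for a supremum of convex functions, concave in the parameter (via Ky Fan's
minimax principle).** Let `G : ℝ → ℝ → ℝ` be convex in `μ' ∈ [μ₁, μ₂]` for every parameter `σ ∈ [σ₁, σ₂]`,
concave in `σ ∈ [σ₁, σ₂]` for every `μ' ∈ [μ₁, μ₂]`, and separately continuous on the two compact intervals, and let
`B(μ') = sup_{σ} G(μ', σ)`. Then every subgradient `ν` of `B` at a point `μ ∈ [μ₁, μ₂]` is a subgradient of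
`G(·, σ₀)` at `μ` for SOME maximiser `σ₀` of `G(μ, ·)` — no strict concavity / uniqueness of the maximiser and no
differentiability in `μ` are needed. Proof: `φ(μ', σ) = G(μ', σ) − ν μ'` is convex–concave, so by `fan_minimax`
`min_{μ'} max_{σ} φ = B(μ) − νμ` is (up to `ε`) achieved by one `σ_ε` against all `μ'`; a limit point `σ₀` of
`σ_ε` works. [folklore: Fan 1953 Thm 2; Hiriart-Urruty–Lemaréchal, Convex Analysis and Minimization Algorithms I,
Thm VI.4.4.2] -/
theorem nsc_subgradient_selection {G : ℝ → ℝ → ℝ} {μ₁ μ₂ σ₁ σ₂ μ ν : ℝ} (hσ : σ₁ ≤ σ₂)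
    (hμ : μ ∈ Set.Icc μ₁ μ₂)
    (hconvex : ∀ σ ∈ Set.Icc σ₁ σ₂, ConvexOn ℝ (Set.Icc μ₁ μ₂) fun μ' => G μ' σ)
    (hconcave : ∀ μ' ∈ Set.Icc μ₁ μ₂, ConcaveOn ℝ (Set.Icc σ₁ σ₂) fun σ => G μ' σ)
    (hcontμ : ∀ σ ∈ Set.Icc σ₁ σ₂, ContinuousOn (fun μ' => G μ' σ) (Set.Icc μ₁ μ₂))
    (hcontσ : ∀ μ' ∈ Set.Icc μ₁ μ₂, ContinuousOn (fun σ => G μ' σ) (Set.Icc σ₁ σ₂))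
    (hν : ∀ μ' ∈ Set.Icc μ₁ μ₂,
      sSup ((G μ) '' Set.Icc σ₁ σ₂) + ν * (μ' - μ) ≤ sSup ((G μ') '' Set.Icc σ₁ σ₂)) :
    ∃ σ₀ ∈ Set.Icc σ₁ σ₂, G μ σ₀ = sSup ((G μ) '' Set.Icc σ₁ σ₂) ∧
      ∀ μ' ∈ Set.Icc μ₁ μ₂, G μ σ₀ + ν * (μ' - μ) ≤ G μ' σ₀ := by
  set I : Set ℝ := Set.Icc μ₁ μ₂ with hI
  set S : Set ℝ := Set.Icc σ₁ σ₂ with hS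
  set M : ℝ := sSup ((G μ) '' S) with hM
  -- suprema over the compact parameter interval are attained
  have hatt : ∀ μ' ∈ I, ∃ σ ∈ S, (∀ σ' ∈ S, G μ' σ' ≤ G μ' σ) ∧ sSup ((G μ') '' S) = G μ' σ := by
    intro μ' hμ'
    obtain ⟨σ, hσS, hmax⟩ :=
      (isCompact_Icc : IsCompact S).exists_isMaxOn ⟨σ₁, Set.left_mem_Icc.2 hσ⟩ (hcontσ μ' hμ')
    have hmax' : ∀ σ' ∈ S, G μ' σ' ≤ G μ' σ := fun σ' hσ' => isMaxOn_iff.mp hmax σ' hσ'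
    refine ⟨σ, hσS, hmax', IsGreatest.csSup_eq ⟨⟨σ, hσS, rfl⟩, ?_⟩⟩
    rintro _ ⟨σ', hσ', rfl⟩
    exact hmax' σ' hσ'
  have hbdd : ∀ μ' ∈ I, BddAbove ((G μ') '' S) := fun μ' hμ' =>
    (isCompact_Icc : IsCompact S).bddAbove_image (hcontσ μ' hμ')
  -- Ky Fan on the compact space `I` against `S`, payoff `φ x y = G x y − ν x`
  haveI : CompactSpace I := isCompact_iff_compactSpace.mp isCompact_Icc
  haveI : Nonempty S := ⟨⟨σ₁, Set.left_mem_Icc.2 hσ⟩⟩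
  set φ : I → S → ℝ := fun x y => G x.1 y.1 - ν * x.1 with hφ
  have hlsc : ∀ y : S, LowerSemicontinuous fun x : I => φ x y := by
    intro y
    apply Continuous.lowerSemicontinuous
    have h1 : Continuous fun x : I => G x.1 y.1 :=
      continuousOn_iff_continuous_restrict.1 (hcontμ y.1 y.2)
    exact h1.sub (continuous_const.mul continuous_subtype_val)
  have hconv : ∀ (x₁ x₂ : I) (t : ℝ), 0 ≤ t → t ≤ 1 →
      ∃ x₀ : I, ∀ y : S, φ x₀ y ≤ t * φ x₁ y + (1 - t) * φ x₂ y := by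
    intro x₁ x₂ t ht0 ht1
    have hmem : t * x₁.1 + (1 - t) * x₂.1 ∈ I :=
      (convex_Icc μ₁ μ₂) x₁.2 x₂.2 ht0 (by linarith) (by ring)
    refine ⟨⟨_, hmem⟩, fun y => ?_⟩
    have key := (hconvex y.1 y.2).2 x₁.2 x₂.2 ht0 (by linarith : 0 ≤ 1 - t) (by ring : t + (1 - t) = 1)
    simp only [smul_eq_mul] at key
    simp only [hφ]
    nlinarith [key]
  have hconc : ∀ (y₁ y₂ : S) (t : ℝ), 0 ≤ t → t ≤ 1 →
      ∃ y₀ : S, ∀ x : I, t * φ x y₁ + (1 - t) * φ x y₂ ≤ φ x y₀ := by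
    intro y₁ y₂ t ht0 ht1
    have hmem : t * y₁.1 + (1 - t) * y₂.1 ∈ S :=
      (convex_Icc σ₁ σ₂) y₁.2 y₂.2 ht0 (by linarith) (by ring)
    refine ⟨⟨_, hmem⟩, fun x => ?_⟩
    have key := (hconcave x.1 x.2).2 y₁.2 y₂.2 ht0 (by linarith : 0 ≤ 1 - t) (by ring : t + (1 - t) = 1)
    simp only [smul_eq_mul] at key
    simp only [hφ]
    nlinarith [key]
  -- for every margin `ε > 0` one parameter beats every `μ'` above `M − νμ − ε`
  have hstep : ∀ ε : ℝ, 0 < ε → ∃ y : S, ∀ x : I, M - ν * μ - ε < φ x y := by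
    intro ε hε
    refine fan_minimax φ hlsc hconv hconc (M - ν * μ - ε) fun x => ?_
    obtain ⟨σ, hσS, -, hsup⟩ := hatt x.1 x.2
    refine ⟨⟨σ, hσS⟩, ?_⟩
    have h1 := hν x.1 x.2
    rw [hsup] at h1
    simp only [hφ]
    linarith
  -- a sequence of such parameters and a limit point
  choose y hy using fun n : ℕ => hstep (1 / ((n : ℝ) + 1)) (by positivity)
  obtain ⟨σ₀, hσ₀S, ψ, hψ, hlim⟩ :=
    (isCompact_Icc : IsCompact S).tendsto_subseq (x := fun n => (y n).1) fun n => (y n).2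
  -- passing to the limit along the subsequence
  have hge : ∀ μ' ∈ I, M - ν * μ ≤ G μ' σ₀ - ν * μ' := by
    intro μ' hμ'
    have hcw : ContinuousWithinAt (fun σ => G μ' σ) S σ₀ := (hcontσ μ' hμ') σ₀ hσ₀S
    have hT : Tendsto (fun n => G μ' ((y (ψ n)).1)) atTop (𝓝 (G μ' σ₀)) := by
      have hin : Tendsto (fun n => (y (ψ n)).1) atTop (𝓝[S] σ₀) :=
        tendsto_nhdsWithin_iff.2 ⟨hlim, Eventually.of_forall fun n => (y (ψ n)).2⟩
      exact hcw.tendsto.comp hin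
    have hT' : Tendsto (fun n => G μ' ((y (ψ n)).1) - ν * μ') atTop (𝓝 (G μ' σ₀ - ν * μ')) :=
      hT.sub tendsto_const_nhds
    have hε : Tendsto (fun n : ℕ => M - ν * μ - 1 / ((ψ n : ℝ) + 1)) atTop (𝓝 (M - ν * μ)) := by
      have h0 : Tendsto (fun n : ℕ => 1 / ((n : ℝ) + 1)) atTop (𝓝 0) :=
        tendsto_one_div_add_atTop_nhds_zero_nat
      have h1 : Tendsto (fun n : ℕ => 1 / ((ψ n : ℝ) + 1)) atTop (𝓝 0) :=
        h0.comp hψ.tendsto_atTop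
      simpa using (tendsto_const_nhds (x := M - ν * μ)).sub h1
    refine le_of_tendsto_of_tendsto hε hT' (Eventually.of_forall fun n => ?_)
    have := hy (ψ n) ⟨μ', hμ'⟩
    simp only [hφ] at this
    exact this.le
  refine ⟨σ₀, hσ₀S, ?_, fun μ' hμ' => ?_⟩
  · apply le_antisymm (le_csSup (hbdd μ hμ) ⟨σ₀, hσ₀S, rfl⟩)
    have := hge μ hμ
    linarith
  · have h1 := hge μ' hμ'
    have h2 : G μ σ₀ ≤ M := le_csSup (hbdd μ hμ) ⟨σ₀, hσ₀S, rfl⟩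
    linarith

/-- **A local supporting line of a convex function is a global one.** If `f` is convex on `[A, B]`, `μ ± η` lie in
`[A, B]` (`η > 0`) and `f μ + ν (x − μ) ≤ f x` on `[μ − η, μ + η]`, then the same inequality holds on all of
`[A, B]` (monotonicity of secant slopes from the base point `μ`). [folklore] -/
theorem nsc_supportingLine_of_local {f : ℝ → ℝ} {A B μ η ν : ℝ} (hf : ConvexOn ℝ (Set.Icc A B) f)
    (hη : 0 < η) (hl : A ≤ μ - η) (hr : μ + η ≤ B)
    (hloc : ∀ x ∈ Set.Icc (μ - η) (μ + η), f μ + ν * (x - μ) ≤ f x) :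
    ∀ x ∈ Set.Icc A B, f μ + ν * (x - μ) ≤ f x := by
  intro x hx
  have hμmem : μ ∈ Set.Icc A B := ⟨by linarith, by linarith⟩
  rcases le_or_gt x (μ + η) with hxr | hxr
  · rcases le_or_gt (μ - η) x with hxl | hxl
    · exact hloc x ⟨hxl, hxr⟩
    · -- `x < μ − η < μ`: slope from `μ` to `x` is at most the slope from `μ` to `μ − η`, which is `≤ ν`
      have hle := hf.secant_mono hμmem hx (show μ - η ∈ Set.Icc A B from ⟨hl, by linarith⟩)
        (by intro e; linarith) (by intro e; linarith) hxl.le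
      have h2 := hloc (μ - η) ⟨le_rfl, by linarith⟩
      -- (f (μ-η) - f μ)/(-η) ≤ ν
      have h3 : (f (μ - η) - f μ) / (μ - η - μ) ≤ ν := by
        rw [show μ - η - μ = -η by ring, div_le_iff_of_neg (by linarith)]
        linarith
      have h4 : (f x - f μ) / (x - μ) ≤ ν := hle.trans h3
      rw [div_le_iff_of_neg (by linarith)] at h4
      linarith
  · -- `μ < μ + η < x`
    have hle := hf.secant_mono hμmem (show μ + η ∈ Set.Icc A B from ⟨by linarith, hr⟩) hx
      (by intro e; linarith) (by intro e; linarith) hxr.le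
    have h2 := hloc (μ + η) ⟨by linarith, le_rfl⟩
    have h3 : ν ≤ (f (μ + η) - f μ) / (μ + η - μ) := by
      rw [show μ + η - μ = η by ring, le_div_iff₀ hη]
      linarith
    have h4 : ν ≤ (f x - f μ) / (x - μ) := h3.trans hle
    rw [le_div_iff₀ (by linarith)] at h4
    linarith

/-! ### The model: NoSplit at one `μ` from a floor level and concavity in `s = h²` -/

/-- **NoSplit at one chemical potential from concavity in the squared source (model core).** Fix a torus
coupling `U`, inverse temperature `β > 0`, seed `g > 0`, source box `[−R, R]` (`R > 0`), a window `[μ₁, μ₂]` and a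
pointwise thermodynamic limit `q` of the sourced torus pressure on `[μ₁, μ₂] × [−R, R]`. Suppose that for some floor
level `0 ≤ s_f ≤ R²` every maximiser `h` of the payoff `h ↦ q μ' h − h²/g` over the box has `s_f ≤ h²`
(`μ' ∈ [μ₁, μ₂]`), and that `s ↦ q μ' √s` is CONCAVE (not necessarily strictly) on `[s_f, R²]` for every interior
`μ'`. Then at every interior `μ`, every subgradient `ν` (on the window) of `B = sup_{box} [q(·,h) − h²/g]` is a
subgradient of `q(·, h₀)` for SOME maximiser `h₀` — the NoSplit property consumed by the two-phase closure of line
`Sketch` v8. Ingredients: evenness and the two Lipschitz bounds of the finite-volume pressure pass to the limit;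
`nsc_subgradient_selection` (Ky Fan) on a small closed neighbourhood of `μ` with parameter `s ∈ [s_f, R²]`;
`nsc_supportingLine_of_local`. [folklore composition] -/
theorem nsc_noSplitAt_of_concaveOn :
    ∀ (U β g R μ₁ μ₂ sf : ℝ), 0 < β → 0 < g → 0 < R → 0 ≤ sf → sf ≤ R ^ 2 → ∀ q : ℝ → ℝ → ℝ,
      (∀ μ ∈ Set.Icc μ₁ μ₂, ∀ h ∈ Set.Icc (-R) R, ∀ κ : ℝ, 0 < κ →
        ∃ L₀ : ℕ, ∀ (L : ℕ) [NeZero L], L₀ ≤ L →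
          |Real.log (Matrix.partitionFn β (dWaveSourceTorus L U μ h)).re / (β * (L : ℝ) ^ 2) - q μ h| ≤ κ) →
      (∀ μ ∈ Set.Icc μ₁ μ₂, ∀ h ∈ Set.Icc (-R) R,
        q μ h - h ^ 2 / g = sSup ((fun h' : ℝ => q μ h' - h' ^ 2 / g) '' Set.Icc (-R) R) → sf ≤ h ^ 2) →
      (∀ μ ∈ Set.Ioo μ₁ μ₂, ConcaveOn ℝ (Set.Icc sf (R ^ 2)) (fun s : ℝ => q μ (Real.sqrt s))) →
      ∀ μ ∈ Set.Ioo μ₁ μ₂, ∀ ν : ℝ,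
        (∀ μ' ∈ Set.Icc μ₁ μ₂,
          sSup ((fun h' : ℝ => q μ h' - h' ^ 2 / g) '' Set.Icc (-R) R) + ν * (μ' - μ) ≤
            sSup ((fun h' : ℝ => q μ' h' - h' ^ 2 / g) '' Set.Icc (-R) R)) →
        ∃ h₀ ∈ Set.Icc (-R) R,
          q μ h₀ - h₀ ^ 2 / g = sSup ((fun h' : ℝ => q μ h' - h' ^ 2 / g) '' Set.Icc (-R) R) ∧
          ∀ μ' ∈ Set.Icc μ₁ μ₂, q μ h₀ + ν * (μ' - μ) ≤ q μ' h₀ := by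
  intro U β g R μ₁ μ₂ sf hβ hg hR hsf0 hsfR q hq hfloor hconc μ hμ ν hν
  -- sequence form (side `n + 1`) of the limit
  have hseq : ∀ μ' ∈ Set.Icc μ₁ μ₂, ∀ h ∈ Set.Icc (-R) R, ∀ κ : ℝ, 0 < κ → ∃ N : ℕ, ∀ n, N ≤ n →
      |Real.log (partitionFn β (dWaveSourceTorus (n + 1) U μ' h)).re / (β * ((n + 1 : ℕ) : ℝ) ^ 2) -
          q μ' h| ≤ κ := by
    intro μ' hμ' h hh κ hκ
    obtain ⟨L₁, hL₁⟩ := hq μ' hμ' h hh κ hκ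
    exact ⟨L₁, fun n hn => hL₁ (n + 1) (by omega)⟩
  -- evenness in `h`
  have heven : ∀ μ' ∈ Set.Icc μ₁ μ₂, ∀ h ∈ Set.Icc (-R) R, q μ' (-h) = q μ' h := by
    intro μ' hμ' h hh
    have hnh : -h ∈ Set.Icc (-R) R := ⟨by linarith [hh.2], by linarith [hh.1]⟩
    have h00 : |q μ' (-h) - q μ' h| ≤ 0 := by
      refine cfb_abs_sub_le_of_limits (hseq μ' hμ' (-h) hnh) (hseq μ' hμ' h hh) fun n => ?_
      rw [partitionFn_dWaveSourceTorus_neg, sub_self, abs_zero]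
    have := abs_nonneg (q μ' (-h) - q μ' h)
    linarith [abs_le.mp h00]
  have habs : ∀ μ' ∈ Set.Icc μ₁ μ₂, ∀ h ∈ Set.Icc (-R) R, q μ' h = q μ' (Real.sqrt (h ^ 2)) := by
    intro μ' hμ' h hh
    rw [Real.sqrt_sq_eq_abs]
    rcases le_or_gt 0 h with h0' | h0'
    · rw [abs_of_nonneg h0']
    · rw [abs_of_neg h0', heven μ' hμ' h hh]
  -- Lipschitz bounds of the limit: `8√2` in `h`, `2` in `μ`
  have hLh : ∀ μ' ∈ Set.Icc μ₁ μ₂, ∀ h ∈ Set.Icc (-R) R, ∀ h' ∈ Set.Icc (-R) R,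
      |q μ' h - q μ' h'| ≤ 8 * Real.sqrt 2 * |h - h'| := by
    intro μ' hμ' h hh h' hh'
    refine cfb_abs_sub_le_of_limits (hseq μ' hμ' h hh) (hseq μ' hμ' h' hh') fun n => ?_
    exact abs_sourcedPressure_sub_le (n + 1) U μ' hβ h h'
  have hLμ : ∀ h ∈ Set.Icc (-R) R, ∀ μ' ∈ Set.Icc μ₁ μ₂, ∀ μ'' ∈ Set.Icc μ₁ μ₂,
      |q μ' h - q μ'' h| ≤ 2 * |μ' - μ''| := by
    intro h hh μ' hμ' μ'' hμ''
    refine cfb_abs_sub_le_of_limits (hseq μ' hμ' h hh) (hseq μ'' hμ'' h hh) fun n => ?_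
    exact cfb_abs_sourcedPressure_sub_mu_le (n + 1) U h hβ μ' μ''
  -- convexity in `μ` of the limit
  have hcvx : ∀ h ∈ Set.Icc (-R) R, ConvexOn ℝ (Set.Icc μ₁ μ₂) (fun μ' => q μ' h) := by
    intro h hh
    refine cfc_convexOn_of_limit (convex_Icc μ₁ μ₂)
      (f := fun n μ' => Real.log (partitionFn β (dWaveSourceTorus (n + 1) U μ' h)).re /
        (β * ((n + 1 : ℕ) : ℝ) ^ 2)) (fun n => ?_) (fun μ' hμ' κ hκ => hseq μ' hμ' h hh κ hκ)
    exact (cfb_convexOn_sourcedPressure (n + 1) U h hβ).subset (Set.subset_univ _) (convex_Icc μ₁ μ₂)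
  -- continuity of the payoff in `h` on the box, maximisers, boundedness
  have hcontP : ∀ μ' ∈ Set.Icc μ₁ μ₂,
      ContinuousOn (fun h' : ℝ => q μ' h' - h' ^ 2 / g) (Set.Icc (-R) R) := fun μ' hμ' =>
    (danskin_continuousOn_of_lipschitz (hLh μ' hμ')).sub ((continuous_pow 2).div_const g).continuousOn
  have hmaxP : ∀ μ' ∈ Set.Icc μ₁ μ₂, ∃ hb ∈ Set.Icc (-R) R,
      (∀ h' ∈ Set.Icc (-R) R, q μ' h' - h' ^ 2 / g ≤ q μ' hb - hb ^ 2 / g) ∧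
      sSup ((fun h' : ℝ => q μ' h' - h' ^ 2 / g) '' Set.Icc (-R) R) = q μ' hb - hb ^ 2 / g := by
    intro μ' hμ'
    obtain ⟨hb, hbS, hmax⟩ := (isCompact_Icc : IsCompact (Set.Icc (-R) R)).exists_isMaxOn
      ⟨0, by constructor <;> linarith⟩ (hcontP μ' hμ')
    have hmax' : ∀ h' ∈ Set.Icc (-R) R, q μ' h' - h' ^ 2 / g ≤ q μ' hb - hb ^ 2 / g :=
      fun h' hh' => isMaxOn_iff.mp hmax h' hh'
    refine ⟨hb, hbS, hmax', IsGreatest.csSup_eq ⟨⟨hb, hbS, rfl⟩, ?_⟩⟩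
    rintro _ ⟨h', hh', rfl⟩
    exact hmax' h' hh'
  have hbddP : ∀ μ' ∈ Set.Icc μ₁ μ₂, BddAbove ((fun h' : ℝ => q μ' h' - h' ^ 2 / g) '' Set.Icc (-R) R) :=
    fun μ' hμ' => (isCompact_Icc : IsCompact (Set.Icc (-R) R)).bddAbove_image (hcontP μ' hμ')
  -- the parameter interval `S = [s_f, R²]` and the payoff `G μ' s = q μ' √s − s/g`
  have hsqrt_mem : ∀ s ∈ Set.Icc sf (R ^ 2), Real.sqrt s ∈ Set.Icc (-R) R := by
    intro s hs
    refine ⟨by linarith [Real.sqrt_nonneg s], ?_⟩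
    rw [← Real.sqrt_sq hR.le]
    exact Real.sqrt_le_sqrt hs.2
  set G : ℝ → ℝ → ℝ := fun μ' s => q μ' (Real.sqrt s) - s / g with hG
  have hcontG : ∀ μ' ∈ Set.Icc μ₁ μ₂, ContinuousOn (fun s => G μ' s) (Set.Icc sf (R ^ 2)) := by
    intro μ' hμ'
    have h1 : ContinuousOn (fun s => q μ' (Real.sqrt s)) (Set.Icc sf (R ^ 2)) :=
      (danskin_continuousOn_of_lipschitz (hLh μ' hμ')).comp Real.continuous_sqrt.continuousOn hsqrt_mem
    exact h1.sub (continuousOn_id.div_const g)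
  have hbddG : ∀ μ' ∈ Set.Icc μ₁ μ₂, BddAbove ((G μ') '' Set.Icc sf (R ^ 2)) :=
    fun μ' hμ' => (isCompact_Icc : IsCompact (Set.Icc sf (R ^ 2))).bddAbove_image (hcontG μ' hμ')
  -- the two suprema agree on the window (floor + evenness)
  have hSup : ∀ μ' ∈ Set.Icc μ₁ μ₂, sSup ((G μ') '' Set.Icc sf (R ^ 2)) =
      sSup ((fun h' : ℝ => q μ' h' - h' ^ 2 / g) '' Set.Icc (-R) R) := by
    intro μ' hμ'
    apply le_antisymm
    · refine csSup_le ⟨G μ' sf, ⟨sf, ⟨le_rfl, hsfR⟩, rfl⟩⟩ ?_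
      rintro _ ⟨s, hs, rfl⟩
      have hs0 : 0 ≤ s := hsf0.trans hs.1
      have e : G μ' s = q μ' (Real.sqrt s) - Real.sqrt s ^ 2 / g := by
        simp only [hG, Real.sq_sqrt hs0]
      rw [e]
      exact le_csSup (hbddP μ' hμ') ⟨Real.sqrt s, hsqrt_mem s hs, rfl⟩
    · obtain ⟨hb, hbS, -, hsup⟩ := hmaxP μ' hμ'
      have hfl : sf ≤ hb ^ 2 := hfloor μ' hμ' hb hbS hsup.symm
      have hb2 : hb ^ 2 ∈ Set.Icc sf (R ^ 2) := by
        refine ⟨hfl, ?_⟩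
        have habs' : |hb| ≤ R := abs_le.mpr hbS
        nlinarith [abs_nonneg hb, sq_abs hb]
      have e : G μ' (hb ^ 2) = q μ' hb - hb ^ 2 / g := by
        simp only [hG]
        rw [← habs μ' hμ' hb hbS]
      rw [hsup, ← e]
      exact le_csSup (hbddG μ' hμ') ⟨hb ^ 2, hb2, rfl⟩
  -- a closed neighbourhood `[μ − η, μ + η]` of `μ` inside the open window
  obtain ⟨η, hη, hηl, hηr⟩ : ∃ η : ℝ, 0 < η ∧ μ₁ < μ - η ∧ μ + η < μ₂ :=
    ⟨min (μ - μ₁) (μ₂ - μ) / 2, by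
      have := hμ.1; have := hμ.2; positivity, by
      have h1 := min_le_left (μ - μ₁) (μ₂ - μ); linarith [hμ.1], by
      have h1 := min_le_right (μ - μ₁) (μ₂ - μ); linarith [hμ.2]⟩
  have hIsub : Set.Icc (μ - η) (μ + η) ⊆ Set.Icc μ₁ μ₂ := fun x hx => ⟨by linarith [hx.1], by linarith [hx.2]⟩
  have hIsub' : Set.Icc (μ - η) (μ + η) ⊆ Set.Ioo μ₁ μ₂ := fun x hx => ⟨by linarith [hx.1], by linarith [hx.2]⟩
  have hμI : μ ∈ Set.Icc (μ - η) (μ + η) := ⟨by linarith, by linarith⟩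
  -- Ky Fan selection on `[μ − η, μ + η] × [s_f, R²]`
  obtain ⟨σ₀, hσ₀, hval, hsub⟩ := nsc_subgradient_selection (G := G) (ν := ν) hsfR hμI
    (fun s hs => by
      have h1 : ConvexOn ℝ (Set.Icc (μ - η) (μ + η)) (fun μ' => q μ' (Real.sqrt s)) :=
        (hcvx (Real.sqrt s) (hsqrt_mem s hs)).subset hIsub (convex_Icc _ _)
      simpa only [hG, Pi.sub_def] using h1.sub (concaveOn_const (s / g) (convex_Icc _ _)))
    (fun μ' hμ' => by
      have h1 := hconc μ' (hIsub' hμ')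
      have h2 : ConvexOn ℝ (Set.Icc sf (R ^ 2)) (fun s : ℝ => s / g) := by
        have := (convexOn_id (convex_Icc sf (R ^ 2))).smul (show (0 : ℝ) ≤ 1 / g by positivity)
        refine this.congr fun s _ => ?_
        simp only [smul_eq_mul, id]
        ring
      simpa only [hG, Pi.sub_def] using h1.sub h2)
    (fun s hs => by
      have h1 : ContinuousOn (fun μ' => q μ' (Real.sqrt s)) (Set.Icc μ₁ μ₂) :=
        danskin_continuousOn_of_lipschitz fun μ' hμ' μ'' hμ'' => hLμ (Real.sqrt s) (hsqrt_mem s hs) μ' hμ' μ'' hμ''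
      simpa only [hG, Pi.sub_def] using (h1.mono hIsub).sub continuousOn_const)
    (fun μ' hμ' => hcontG μ' (hIsub hμ'))
    (fun μ' hμ' => by
      rw [hSup μ (hIsub hμI), hSup μ' (hIsub hμ')]
      exact hν μ' (hIsub hμ'))
  -- the selected maximiser, as a source `h₀ = √σ₀`
  have hσ₀0 : 0 ≤ σ₀ := hsf0.trans hσ₀.1
  refine ⟨Real.sqrt σ₀, hsqrt_mem σ₀ hσ₀, ?_, ?_⟩
  · rw [Real.sq_sqrt hσ₀0, ← hSup μ ⟨hμ.1.le, hμ.2.le⟩, ← hval]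
  · -- local supporting line from the selection, globalised by convexity of `q(·, h₀)`
    have hloc : ∀ x ∈ Set.Icc (μ - η) (μ + η), q μ (Real.sqrt σ₀) + ν * (x - μ) ≤ q x (Real.sqrt σ₀) := by
      intro x hx
      have := hsub x hx
      simp only [hG] at this
      linarith
    exact nsc_supportingLine_of_local (hcvx (Real.sqrt σ₀) (hsqrt_mem σ₀ hσ₀)) hη hηl.le hηr.le hloc

/-! ### Finite volume to limit -/

/-- **Eventual finite-volume concavity in `s = h²` passes to every pointwise limit** (any `β`, any floor level
`s_f`, box `[−R, R]`, `R ≥ 0`): non-strict concavity is preserved by pointwise limits, so no volume-uniform modulus is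
needed (contrast `dsc_deepStrictConcavity_of_finiteVolumeModulus`). [folklore] -/
theorem nsc_concaveOn_sqrt_of_finiteVolume {U β R μ₁ μ₂ sf μ : ℝ} (hR : 0 ≤ R)
    {q : ℝ → ℝ → ℝ} (hμ : μ ∈ Set.Icc μ₁ μ₂)
    (hq : ∀ μ ∈ Set.Icc μ₁ μ₂, ∀ h ∈ Set.Icc (-R) R, ∀ κ : ℝ, 0 < κ →
      ∃ L₀ : ℕ, ∀ (L : ℕ) [NeZero L], L₀ ≤ L →
        |Real.log (Matrix.partitionFn β (dWaveSourceTorus L U μ h)).re / (β * (L : ℝ) ^ 2) - q μ h| ≤ κ)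
    (hfv : ∃ L₀ : ℕ, ∀ (L : ℕ) [NeZero L], L₀ ≤ L →
      ConcaveOn ℝ (Set.Icc sf (R ^ 2)) (fun s : ℝ =>
        Real.log (Matrix.partitionFn β (dWaveSourceTorus L U μ (Real.sqrt s))).re / (β * (L : ℝ) ^ 2))) :
    ConcaveOn ℝ (Set.Icc sf (R ^ 2)) (fun s : ℝ => q μ (Real.sqrt s)) := by
  obtain ⟨L₀, hL₀⟩ := hfv
  have hsqrt_mem : ∀ s ∈ Set.Icc sf (R ^ 2), Real.sqrt s ∈ Set.Icc (-R) R := by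
    intro s hs
    refine ⟨by linarith [Real.sqrt_nonneg s], ?_⟩
    rw [← Real.sqrt_sq hR]
    exact Real.sqrt_le_sqrt hs.2
  rw [← neg_convexOn_iff]
  refine cfc_convexOn_of_limit (convex_Icc sf (R ^ 2))
    (f := fun n s => -(Real.log (partitionFn β (dWaveSourceTorus (n + L₀ + 1) U μ (Real.sqrt s))).re /
      (β * ((n + L₀ + 1 : ℕ) : ℝ) ^ 2))) (fun n => ?_) (fun s hs κ hκ => ?_)
  · have := (hL₀ (n + L₀ + 1) (by omega)).neg
    simpa only [Pi.neg_def] using this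
  · obtain ⟨L₁, hL₁⟩ := hq μ hμ (Real.sqrt s) (hsqrt_mem s hs) κ hκ
    refine ⟨L₁, fun n hn => ?_⟩
    have := hL₁ (n + L₀ + 1) (by omega)
    simp only [Pi.neg_apply]
    rw [← abs_neg]
    convert this using 2
    ring

end

end Summit.HubbardSuperconductivity.HubbardSuperconductivity.Theorems
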